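import Summits.CriticalPhenomena.PercolationContinuityZ3.Theorems.PercNearOneGluingAdditiveGluingOffClusterAssociation
import HarnessLib

/-!
# Crux `PercNearOneGluing.AdditiveGluing` (stmt-CriticalPhenomena-4576), line `tieline`: the UNCENTERED covariance transfer

Support file (`--supports stmt-CriticalPhenomena-4576`, helper, seat (d) exchange-certificate form, gen 9).  No definitions,
no named facts, no sorries (the two `notation3`s are the source abbreviations of `…OffClusterAssociation.lean`).

Setting: `μ = prodBernoulli w` on a finite vertex type, five vertices `u, b, y, o, c` with `c ≠ u`.  Write
`N = {c ↮ u}`, `D = {y ↮ u}` and `τ = μ(u ↔ b)`.  The **uncentered transfer**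

  `μ(N) · [τ · μ(D ∩ {y ↔ o}) − μ(D ∩ {y ↔ o} ∩ {u ↔ b})] ≥ μ(N ∩ {c ↔ o}) · [τ · μ(D ∩ {y ↔ c}) − μ(D ∩ {y ↔ c} ∩ {u ↔ b})]`

(`uncenteredTransfer`).  Reading: `m(x) := τ μ(y↔x, y↮u) − μ(y↔x, y↮u, u↔b) = E[1{u ∉ C_y} 1{x ∈ C_y} (τ − P(u↔b | C_y))] ≥ 0` is the
drop in `u–b` connectivity caused by the cluster of `y` reaching `x`; the lemma says `m(o) ≥ μ(o↔c | c↮u) · m(c)`.  This is the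
`(κ, θ) = (τ, μ(o↔c | c↮u))` corner of the registered kernel (T) = `stub_k0CovTransferQ_c9` written at roles `(o,b,u,y,c)`:
(T) is the same inequality with the CENTERED weight `P(u↮b | y↮u) − P(u↮b | C_y)` and the smaller threshold `μ(o↔c | c↮u, c↮y)`;
the corner is exactly the pattern term `B(∅,∅,{y})` of the weighted star expansion of (T) at a pendant `v` (EXCHCERT-g9 §8–§9
in the crux directory) and, unlike (T), it is a theorem.
Proof (van den Berg–Häggström–Kahn): (1) drop the part of the left side on `{y ↮ c}` — it is `≥ 0` because given the cluster
`C_y = W` the configuration off `W̄` is a fresh percolation ([VandenbergHaggstromKahn2005], display (10)) and `{u ↔ b off W̄} ⊆ {u ↔ b}`;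
(2) on `{y ↔ c}` the cluster of `y` is the cluster of `c`, and BHK's Theorem 1.3 ("given `c ↮ u` the cluster of `c` is positively
associated") applied to the increasing functions `W ↦ 1{y ∈ V(W)} (τ − P(u ↔ b off W̄))` and `W ↦ 1{o ∈ V(W)}` of `W = C_c` gives
the claim.  [cite: VandenbergHaggstromKahn2005, Thm. 1.3 (p. 6), display (10) (pp. 7–8) — corollary]
-/

namespace Summit.CriticalPhenomena.PercolationContinuityZ3.Cruxes.AdditiveGluing.TieLine

open MeasureTheory Set
open Literature.Probability.LatticeModels (prodBernoulli)
open Literature.Probability.Percolation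
open Literature.Probability.Percolation.BHK2006
open Literature.Probability.Percolation.DecisionTree (ind ind_of_mem ind_of_not_mem ind_nonneg)

noncomputable section
open scoped Classical

local notation3 (prettyPrint := false) "D⟦" s ", " X "⟧" => {ω | ∀ x ∈ X, ¬ (openGraph ω).Reachable s x}
local notation3 (prettyPrint := false) "B⟦" W ", " s "⟧" => {e | ∃ v ∈ e, v = s ∨ ∃ e' ∈ W, v ∈ e'}

namespace UncenteredTransfer

variable {V : Type*} [Fintype V] (w : Sym2 V → unitInterval)

omit [Fintype V] in
/-- Weights are in `[0,1]`. [folklore] -/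
theorem wr_nonneg (e : Sym2 V) : 0 ≤ (fun e => (w e : ℝ)) e := (w e).2.1

omit [Fintype V] in
/-- Weights are in `[0,1]`. [folklore] -/
theorem wr_le_one (e : Sym2 V) : (fun e => (w e : ℝ)) e ≤ 1 := (w e).2.2

/-- `Σ_ω weight ω = 1`. [folklore] -/
theorem sum_weight : ∑ ω : Set (Sym2 V), weight (fun e => (w e : ℝ)) ω = 1 := by
  have h1 := integral_prodBernoulli_eq_sum w fun _ => (1 : ℝ)
  simp only [integral_const, probReal_univ, smul_eq_mul, mul_one] at h1
  exact h1.symm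

/-- `μ(A) = Σ_ω weight ω · 1_A(ω)`. [folklore] -/
theorem real_eq_sum (A : Set (BondConfig V)) :
    (prodBernoulli w).real A = ∑ ω : Set (Sym2 V), weight (fun e => (w e : ℝ)) ω * ind A ω := by
  rw [← integral_indicator_one (MeasurableSet.of_discrete), integral_prodBernoulli_eq_sum]
  refine Finset.sum_congr rfl fun ω _ => ?_
  by_cases hω : ω ∈ A
  · rw [Set.indicator_of_mem hω, ind_of_mem hω, Pi.one_apply]
  · rw [Set.indicator_of_notMem hω, ind_of_not_mem hω, mul_zero]

omit [Fintype V] in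
/-- `1_{A ∩ B} = 1_A · 1_B`. [folklore] -/
theorem ind_inter (A B : Set (BondConfig V)) (ω : BondConfig V) : ind (A ∩ B) ω = ind A ω * ind B ω := by
  by_cases hA : ω ∈ A <;> by_cases hB : ω ∈ B <;>
    simp [ind_of_mem, ind_of_not_mem, hA, hB, Set.mem_inter_iff]

omit [Fintype V] in
/-- `1_{{ω | R (C_s ω)}}(ω) = 1{R (C_s ω)}`. [folklore] -/
theorem ind_setOf_eq {s : V} (R : Set (Sym2 V) → Prop) (ω : BondConfig V) :
    ind {ω : Set (Sym2 V) | R (openEdgeCluster ω s)} ω = if R (openEdgeCluster ω s) then (1 : ℝ) else 0 := by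
  by_cases hR : R (openEdgeCluster ω s)
  · rw [ind_of_mem (show ω ∈ {ω : Set (Sym2 V) | R (openEdgeCluster ω s)} from hR), if_pos hR]
  · rw [ind_of_not_mem (show ω ∉ {ω : Set (Sym2 V) | R (openEdgeCluster ω s)} from hR), if_neg hR]

omit [Fintype V] in
/-- `x ∈ {s} ∪ V(C_s(ω))` iff `s ↔ x`. [cite: VandenbergHaggstromKahn2005, §1 p. 3] -/
theorem memV_iff (ω : BondConfig V) (s x : V) :
    (x = s ∨ ∃ e ∈ openEdgeCluster ω s, x ∈ e) ↔ (openGraph ω).Reachable s x :=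
  (reachable_iff_exists_mem_openEdgeCluster ω s x).symm

omit [Fintype V] in
/-- Reachability is monotone in the open set. [folklore] -/
theorem reach_mono {A A' : Set (Sym2 V)} (h : A ⊆ A') {x z : V} (hr : (openGraph A).Reachable x z) :
    (openGraph A').Reachable x z :=
  hr.mono (openGraph_le h)

/-- The off-`W̄` connection probability `P(u ↔ b in η ∖ W̄)` is at most `μ(u ↔ b)`. [folklore] -/
theorem offConn_le (W : Set (Sym2 V)) (s u b : V) :
    ∑ η : Set (Sym2 V), weight (fun e => (w e : ℝ)) η * (if (openGraph (η \ B⟦W, s⟧)).Reachable u b then (1 : ℝ) else 0) ≤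
      (prodBernoulli w).real (openConn u b) := by
  rw [real_eq_sum]
  refine Finset.sum_le_sum fun η _ => mul_le_mul_of_nonneg_left ?_ (weight_nonneg (wr_nonneg w) (wr_le_one w) η)
  by_cases h : (openGraph (η \ B⟦W, s⟧)).Reachable u b
  · rw [if_pos h, ind_of_mem (show η ∈ openConn u b from reach_mono Set.sdiff_subset h)]
  · rw [if_neg h]; exact ind_nonneg _ _

/-- The off-`W̄` connection probability is antitone in `W`. [folklore] -/
theorem offConn_anti (s u b : V) :
    Antitone fun W : Set (Sym2 V) =>
      ∑ η : Set (Sym2 V), weight (fun e => (w e : ℝ)) η * (if (openGraph (η \ B⟦W, s⟧)).Reachable u b then (1 : ℝ) else 0) := by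
  intro W W' hWW'
  refine Finset.sum_le_sum fun η _ => mul_le_mul_of_nonneg_left ?_ (weight_nonneg (wr_nonneg w) (wr_le_one w) η)
  by_cases h : (openGraph (η \ B⟦W', s⟧)).Reachable u b
  · rw [if_pos h, if_pos (reach_mono (Set.sdiff_subset_sdiff_right (bar_mono s hWW')) h)]
  · rw [if_neg h]; split_ifs <;> norm_num

/-- **Display (10) for a connection weight.**  For `D = {s ↮ u}` and a predicate `R` of the cluster `C_s`:
`μ(D ∩ {R(C_s)} ∩ {u ↔ b}) = Σ_ω weight(ω) 1_D 1{R} · P(u ↔ b off C̄_s(ω))`  (on `D`, `u ↔ b` iff `u ↔ b` off `C̄_s`; then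
block Fubini on `{C_s = W}`). [cite: VandenbergHaggstromKahn2005, §1 pp. 7–8, (10)] -/
theorem real_inter_conn_eq_sum (s u b : V) (R : Set (Sym2 V) → Prop) :
    (prodBernoulli w).real (D⟦s, ({u} : Set V)⟧ ∩ {ω | R (openEdgeCluster ω s)} ∩ openConn u b) =
      ∑ ω : Set (Sym2 V), weight (fun e => (w e : ℝ)) ω *
        ((∑ η : Set (Sym2 V), weight (fun e => (w e : ℝ)) η *
            ((if R (openEdgeCluster ω s) then (1 : ℝ) else 0) *
              (if (openGraph (η \ B⟦openEdgeCluster ω s, s⟧)).Reachable u b then (1 : ℝ) else 0))) *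
          ind D⟦s, ({u} : Set V)⟧ ω) := by
  have hD : ∀ ω : Set (Sym2 V), ω ∈ D⟦s, ({u} : Set V)⟧ ↔ ∀ x ∈ ({u} : Set V), ¬ (openGraph ω).Reachable s x :=
    fun ω => Iff.rfl
  have key := OffCluster.sum_cond_cluster_off_ind (fun e => (w e : ℝ)) (sum_weight w) s ({u} : Set V)
    (fun C E => (if R C then (1 : ℝ) else 0) * (if (openGraph E).Reachable u b then (1 : ℝ) else 0)) hD
  rw [real_eq_sum]
  have hpt : ∀ ω : Set (Sym2 V), weight (fun e => (w e : ℝ)) ω * ind (D⟦s, ({u} : Set V)⟧ ∩ {ω | R (openEdgeCluster ω s)} ∩ openConn u b) ω =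
      weight (fun e => (w e : ℝ)) ω * ((if R (openEdgeCluster ω s) then (1 : ℝ) else 0) *
        (if (openGraph (ω \ B⟦openEdgeCluster ω s, s⟧)).Reachable u b then (1 : ℝ) else 0) * ind D⟦s, ({u} : Set V)⟧ ω) := by
    intro ω
    by_cases hDω : ω ∈ D⟦s, ({u} : Set V)⟧
    · have hus : ¬ (openGraph ω).Reachable u s := fun h => hDω u rfl h.symm
      rw [ind_inter, ind_inter, ind_of_mem hDω]
      have h1 : ind {ω : Set (Sym2 V) | R (openEdgeCluster ω s)} ω = if R (openEdgeCluster ω s) then (1 : ℝ) else 0 :=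
        ind_setOf_eq R ω
      have h2 : ind (openConn u b) ω = if (openGraph (ω \ B⟦openEdgeCluster ω s, s⟧)).Reachable u b then (1 : ℝ) else 0 := by
        by_cases hub : (openGraph ω).Reachable u b
        · rw [ind_of_mem (show ω ∈ openConn u b from hub), if_pos ((OffCluster.reachable_off_iff hus b).1 hub)]
        · rw [ind_of_not_mem (show ω ∉ openConn u b from hub), if_neg (fun h => hub ((OffCluster.reachable_off_iff hus b).2 h))]
      rw [h1, h2]; ring
    · rw [ind_of_not_mem (fun h => hDω h.1.1), ind_of_not_mem hDω]; ring
  rw [Finset.sum_congr rfl fun ω _ => hpt ω, key]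

/-- **Display (10), connection-free version**: `μ(D ∩ {R(C_s)}) = Σ_ω weight(ω) 1{R} 1_D`. [folklore] -/
theorem real_inter_eq_sum (s u : V) (R : Set (Sym2 V) → Prop) :
    (prodBernoulli w).real (D⟦s, ({u} : Set V)⟧ ∩ {ω | R (openEdgeCluster ω s)}) =
      ∑ ω : Set (Sym2 V), weight (fun e => (w e : ℝ)) ω * ((if R (openEdgeCluster ω s) then (1 : ℝ) else 0) * ind D⟦s, ({u} : Set V)⟧ ω) := by
  rw [real_eq_sum]
  refine Finset.sum_congr rfl fun ω _ => ?_
  by_cases hDω : ω ∈ D⟦s, ({u} : Set V)⟧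
  · rw [ind_inter, ind_of_mem hDω, ind_setOf_eq R ω]; ring
  · rw [ind_of_not_mem (fun h => hDω h.1), ind_of_not_mem hDω]; ring

/-- **Step 1 (the dropped part is nonnegative).**  For `D = {y ↮ u}` and any predicate `R` of `C_y`:
`μ(D ∩ {R} ∩ {u ↔ b}) ≤ μ(u ↔ b) · μ(D ∩ {R})` — given `C_y` the edges off `C̄_y` are fresh and `{u ↔ b off C̄_y} ⊆ {u ↔ b}`.
[cite: VandenbergHaggstromKahn2005, §1 pp. 7–8, (10) — corollary] -/
theorem real_inter_conn_le (y u b : V) (R : Set (Sym2 V) → Prop) :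
    (prodBernoulli w).real (D⟦y, ({u} : Set V)⟧ ∩ {ω | R (openEdgeCluster ω y)} ∩ openConn u b) ≤
      (prodBernoulli w).real (openConn u b) * (prodBernoulli w).real (D⟦y, ({u} : Set V)⟧ ∩ {ω | R (openEdgeCluster ω y)}) := by
  rw [real_inter_conn_eq_sum, real_inter_eq_sum, Finset.mul_sum]
  refine Finset.sum_le_sum fun ω _ => ?_
  have hw := weight_nonneg (wr_nonneg w) (wr_le_one w) ω
  have hi : 0 ≤ (if R (openEdgeCluster ω y) then (1 : ℝ) else 0) := by split_ifs <;> norm_num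
  have hle := offConn_le w (openEdgeCluster ω y) y u b
  have hsum : (∑ η : Set (Sym2 V), weight (fun e => (w e : ℝ)) η * ((if R (openEdgeCluster ω y) then (1 : ℝ) else 0) *
      (if (openGraph (η \ B⟦openEdgeCluster ω y, y⟧)).Reachable u b then (1 : ℝ) else 0))) =
      (if R (openEdgeCluster ω y) then (1 : ℝ) else 0) * ∑ η : Set (Sym2 V), weight (fun e => (w e : ℝ)) η *
        (if (openGraph (η \ B⟦openEdgeCluster ω y, y⟧)).Reachable u b then (1 : ℝ) else 0) := by
    rw [Finset.mul_sum]; exact Finset.sum_congr rfl fun η _ => by ring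
  rw [hsum]
  calc weight (fun e => (w e : ℝ)) ω * (((if R (openEdgeCluster ω y) then (1 : ℝ) else 0) *
          ∑ η : Set (Sym2 V), weight (fun e => (w e : ℝ)) η *
            (if (openGraph (η \ B⟦openEdgeCluster ω y, y⟧)).Reachable u b then (1 : ℝ) else 0)) * ind D⟦y, ({u} : Set V)⟧ ω)
      ≤ weight (fun e => (w e : ℝ)) ω * (((if R (openEdgeCluster ω y) then (1 : ℝ) else 0) * (prodBernoulli w).real (openConn u b)) *
          ind D⟦y, ({u} : Set V)⟧ ω) :=
        mul_le_mul_of_nonneg_left (mul_le_mul_of_nonneg_right (mul_le_mul_of_nonneg_left hle hi) (ind_nonneg _ _)) hw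
    _ = (prodBernoulli w).real (openConn u b) *
          (weight (fun e => (w e : ℝ)) ω * ((if R (openEdgeCluster ω y) then (1 : ℝ) else 0) * ind D⟦y, ({u} : Set V)⟧ ω)) := by ring

/-- `∫_D h dμ = Σ_ω weight(ω) h(ω) 1_D(ω)`. [folklore] -/
theorem setIntegral_eq_sum (D : Set (BondConfig V)) (h : BondConfig V → ℝ) :
    ∫ ω in D, h ω ∂(prodBernoulli w) = ∑ ω : Set (Sym2 V), weight (fun e => (w e : ℝ)) ω * (h ω * ind D ω) := by
  rw [← integral_indicator (MeasurableSet.of_discrete), integral_prodBernoulli_eq_sum]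
  refine Finset.sum_congr rfl fun ω _ => ?_
  by_cases hω : ω ∈ D
  · rw [Set.indicator_of_mem hω, ind_of_mem hω, mul_one]
  · rw [Set.indicator_of_notMem hω, ind_of_not_mem hω]; ring

/-- **Step 2 (BHK's Theorem 1.3 for the cluster of `c` given `c ↮ u`).**  With `D = {c ↮ u}`, `τ = μ(u ↔ b)`,
`Y = {y ∈ V(C_c)}`, `O = {o ∈ V(C_c)}` (vertex-membership predicates of the cluster of `c`):
`(τ μ(D ∩ Y) - μ(D ∩ Y ∩ {u↔b})) · μ(D ∩ O) ≤ μ(D) · (τ μ(D ∩ Y ∩ O) - μ(D ∩ Y ∩ O ∩ {u↔b}))` — positive association,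
given `c ↮ u`, of the increasing functions `1_Y · (τ - P(u ↔ b off C̄_c))` and `1_O` of `C_c`.
[cite: VandenbergHaggstromKahn2005, Thm. 1.3 (p. 6)] -/
theorem step2 (u b y o c : V) (hcu : c ≠ u) :
    ((prodBernoulli w).real (openConn u b) *
        (prodBernoulli w).real (D⟦c, ({u} : Set V)⟧ ∩ {ω | y = c ∨ ∃ e ∈ openEdgeCluster ω c, y ∈ e}) -
      (prodBernoulli w).real (D⟦c, ({u} : Set V)⟧ ∩ {ω | y = c ∨ ∃ e ∈ openEdgeCluster ω c, y ∈ e} ∩ openConn u b)) *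
      (prodBernoulli w).real (D⟦c, ({u} : Set V)⟧ ∩ {ω | o = c ∨ ∃ e ∈ openEdgeCluster ω c, o ∈ e}) ≤
    (prodBernoulli w).real D⟦c, ({u} : Set V)⟧ *
      ((prodBernoulli w).real (openConn u b) *
          (prodBernoulli w).real (D⟦c, ({u} : Set V)⟧ ∩
            {ω | (y = c ∨ ∃ e ∈ openEdgeCluster ω c, y ∈ e) ∧ (o = c ∨ ∃ e ∈ openEdgeCluster ω c, o ∈ e)}) -
        (prodBernoulli w).real (D⟦c, ({u} : Set V)⟧ ∩
            {ω | (y = c ∨ ∃ e ∈ openEdgeCluster ω c, y ∈ e) ∧ (o = c ∨ ∃ e ∈ openEdgeCluster ω c, o ∈ e)} ∩ openConn u b)) := by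
  set τ : ℝ := (prodBernoulli w).real (openConn u b) with hτ
  -- the two increasing functions of `W = C_c`
  set S : Set (Sym2 V) → ℝ := fun W => ∑ η : Set (Sym2 V), weight (fun e => (w e : ℝ)) η *
    (if (openGraph (η \ B⟦W, c⟧)).Reachable u b then (1 : ℝ) else 0) with hS
  set Φ₁ : Set (Sym2 V) → ℝ := fun W => (if (y = c ∨ ∃ e ∈ W, y ∈ e) then (1 : ℝ) else 0) * (τ - S W) with hΦ₁
  set Φ₂ : Set (Sym2 V) → ℝ := fun W => if (o = c ∨ ∃ e ∈ W, o ∈ e) then (1 : ℝ) else 0 with hΦ₂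
  have hmemV_mono : ∀ (x : V) ⦃W W' : Set (Sym2 V)⦄, W ⊆ W' → (x = c ∨ ∃ e ∈ W, x ∈ e) → (x = c ∨ ∃ e ∈ W', x ∈ e) := by
    rintro x W W' h (hx | ⟨e, he, hxe⟩)
    exacts [Or.inl hx, Or.inr ⟨e, h he, hxe⟩]
  have hΦ₂m : Monotone Φ₂ := by
    intro W W' hWW'
    simp only [hΦ₂]
    by_cases hW : (o = c ∨ ∃ e ∈ W, o ∈ e)
    · rw [if_pos hW, if_pos (hmemV_mono o hWW' hW)]
    · rw [if_neg hW]; split_ifs <;> norm_num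
  have hΦ₁m : Monotone Φ₁ := by
    intro W W' hWW'
    simp only [hΦ₁]
    have h2 : τ - S W ≤ τ - S W' := sub_le_sub_left (offConn_anti w c u b hWW') τ
    have h3 : 0 ≤ τ - S W := sub_nonneg.2 (offConn_le w W c u b)
    by_cases hW : (y = c ∨ ∃ e ∈ W, y ∈ e)
    · rw [if_pos hW, if_pos (hmemV_mono y hWW' hW), one_mul, one_mul]; exact h2
    · rw [if_neg hW, zero_mul]
      exact mul_nonneg (by split_ifs <;> norm_num) (h3.trans h2)
  have hcu' : c ∉ ({u} : Set V) := fun h => hcu h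
  have h13 := BHK2006_clusterConditionalPositiveAssociation_holds V w c ({u} : Set V) Φ₁ Φ₂ hΦ₁m hΦ₂m hcu'
  -- identify the three integrals
  have eΦ₂ : ∫ ω in D⟦c, ({u} : Set V)⟧, Φ₂ (openEdgeCluster ω c) ∂(prodBernoulli w) =
      (prodBernoulli w).real (D⟦c, ({u} : Set V)⟧ ∩ {ω | o = c ∨ ∃ e ∈ openEdgeCluster ω c, o ∈ e}) := by
    simp only [hΦ₂]
    exact OffCluster.setIntegral_ite_eq _ _ _
  have eΦ₁ : ∫ ω in D⟦c, ({u} : Set V)⟧, Φ₁ (openEdgeCluster ω c) ∂(prodBernoulli w) =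
      τ * (prodBernoulli w).real (D⟦c, ({u} : Set V)⟧ ∩ {ω | y = c ∨ ∃ e ∈ openEdgeCluster ω c, y ∈ e}) -
      (prodBernoulli w).real (D⟦c, ({u} : Set V)⟧ ∩ {ω | y = c ∨ ∃ e ∈ openEdgeCluster ω c, y ∈ e} ∩ openConn u b) := by
    rw [real_inter_conn_eq_sum w c u b (fun W => y = c ∨ ∃ e ∈ W, y ∈ e), real_inter_eq_sum w c u (fun W => y = c ∨ ∃ e ∈ W, y ∈ e),
      setIntegral_eq_sum, Finset.mul_sum, ← Finset.sum_sub_distrib]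
    refine Finset.sum_congr rfl fun ω _ => ?_
    by_cases hY : (y = c ∨ ∃ e ∈ openEdgeCluster ω c, y ∈ e)
    · simp only [hΦ₁, hS, hY, if_true, one_mul]; ring
    · simp [hΦ₁, hY]
  have eΦ₁₂ : ∫ ω in D⟦c, ({u} : Set V)⟧, Φ₁ (openEdgeCluster ω c) * Φ₂ (openEdgeCluster ω c) ∂(prodBernoulli w) =
      τ * (prodBernoulli w).real (D⟦c, ({u} : Set V)⟧ ∩
        {ω | (y = c ∨ ∃ e ∈ openEdgeCluster ω c, y ∈ e) ∧ (o = c ∨ ∃ e ∈ openEdgeCluster ω c, o ∈ e)}) -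
      (prodBernoulli w).real (D⟦c, ({u} : Set V)⟧ ∩
        {ω | (y = c ∨ ∃ e ∈ openEdgeCluster ω c, y ∈ e) ∧ (o = c ∨ ∃ e ∈ openEdgeCluster ω c, o ∈ e)} ∩ openConn u b) := by
    rw [real_inter_conn_eq_sum w c u b (fun W => (y = c ∨ ∃ e ∈ W, y ∈ e) ∧ (o = c ∨ ∃ e ∈ W, o ∈ e)),
      real_inter_eq_sum w c u (fun W => (y = c ∨ ∃ e ∈ W, y ∈ e) ∧ (o = c ∨ ∃ e ∈ W, o ∈ e)),
      setIntegral_eq_sum, Finset.mul_sum, ← Finset.sum_sub_distrib]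
    refine Finset.sum_congr rfl fun ω _ => ?_
    by_cases hY : (y = c ∨ ∃ e ∈ openEdgeCluster ω c, y ∈ e)
    · by_cases hO : (o = c ∨ ∃ e ∈ openEdgeCluster ω c, o ∈ e)
      · simp only [hΦ₁, hΦ₂, hS, hY, hO, if_true, and_self, one_mul, mul_one]; ring
      · simp [hΦ₁, hΦ₂, hY, hO]
    · simp [hΦ₁, hΦ₂, hY]
  rw [eΦ₁, eΦ₂, eΦ₁₂] at h13
  exact h13

omit [Fintype V] in
/-- `ω ∈ D⟦s,{u}⟧ ↔ s ↮ u`. [folklore] -/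
theorem mem_D_singleton (ω : BondConfig V) (s u : V) :
    ω ∈ D⟦s, ({u} : Set V)⟧ ↔ ¬ (openGraph ω).Reachable s u :=
  ⟨fun h => h u rfl, fun h x hx => by rw [Set.mem_singleton_iff.mp hx]; exact h⟩

omit [Fintype V] in
/-- `{c ↮ u} = {c ↔ u}ᶜ`. [folklore] -/
theorem setId_N (c u : V) : D⟦c, ({u} : Set V)⟧ = ((openConn c u)ᶜ : Set (BondConfig V)) := by
  ext ω; rw [mem_D_singleton, Set.mem_compl_iff]; rfl

omit [Fintype V] in
/-- `{c ↮ u} ∩ {y ∈ V(C_c)} = {y ↮ u} ∩ {y ↔ c}`. [folklore] -/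
theorem setId_Y (c u y : V) :
    D⟦c, ({u} : Set V)⟧ ∩ {ω | y = c ∨ ∃ e ∈ openEdgeCluster ω c, y ∈ e} = (openConn y u)ᶜ ∩ openConn y c := by
  ext ω
  simp only [Set.mem_inter_iff, Set.mem_setOf_eq, Set.mem_singleton_iff, forall_eq, memV_iff, Set.mem_compl_iff, openConn]
  constructor
  · rintro ⟨hcu, hcy⟩; exact ⟨fun hyu => hcu (hcy.trans hyu), hcy.symm⟩
  · rintro ⟨hyu, hyc⟩; exact ⟨fun hcu => hyu (hyc.trans hcu), hyc.symm⟩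

omit [Fintype V] in
/-- `{c ↮ u} ∩ {o ∈ V(C_c)} = {c ↮ u} ∩ {c ↔ o}`. [folklore] -/
theorem setId_O (c u o : V) :
    D⟦c, ({u} : Set V)⟧ ∩ {ω | o = c ∨ ∃ e ∈ openEdgeCluster ω c, o ∈ e} = (openConn c u)ᶜ ∩ openConn c o := by
  ext ω
  simp only [Set.mem_inter_iff, Set.mem_setOf_eq, Set.mem_singleton_iff, forall_eq, memV_iff, Set.mem_compl_iff, openConn]

omit [Fintype V] in
/-- `{c ↮ u} ∩ {y, o ∈ V(C_c)} = {y ↮ u} ∩ {y ↔ o} ∩ {y ↔ c}`. [folklore] -/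
theorem setId_YO (c u y o : V) :
    D⟦c, ({u} : Set V)⟧ ∩ {ω | (y = c ∨ ∃ e ∈ openEdgeCluster ω c, y ∈ e) ∧ (o = c ∨ ∃ e ∈ openEdgeCluster ω c, o ∈ e)} =
      (openConn y u)ᶜ ∩ openConn y o ∩ openConn y c := by
  ext ω
  simp only [Set.mem_inter_iff, Set.mem_setOf_eq, Set.mem_singleton_iff, forall_eq, memV_iff, Set.mem_compl_iff, openConn]
  constructor
  · rintro ⟨hcu, hcy, hco⟩; exact ⟨⟨fun hyu => hcu (hcy.trans hyu), hcy.symm.trans hco⟩, hcy.symm⟩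
  · rintro ⟨⟨hyu, hyo⟩, hyc⟩; exact ⟨fun hcu => hyu (hyc.trans hcu), hyc.symm, hyc.symm.trans hyo⟩

omit [Fintype V] in
/-- `{c ↮ u} ∩ {y, o ∈ V(C_c)} ∩ {u ↔ b} = {y ↮ u} ∩ {y ↔ o} ∩ {u ↔ b} ∩ {y ↔ c}`. [folklore] -/
theorem setId_YO_conn (c u y o b : V) :
    D⟦c, ({u} : Set V)⟧ ∩ {ω | (y = c ∨ ∃ e ∈ openEdgeCluster ω c, y ∈ e) ∧ (o = c ∨ ∃ e ∈ openEdgeCluster ω c, o ∈ e)} ∩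
        openConn u b = (openConn y u)ᶜ ∩ openConn y o ∩ openConn u b ∩ openConn y c := by
  rw [setId_YO, Set.inter_right_comm]

omit [Fintype V] in
/-- `{y ↮ u} ∩ {o ∈ V(C_y), c ∉ V(C_y)} = ({y ↮ u} ∩ {y ↔ o}) ∖ {y ↔ c}`. [folklore] -/
theorem setId_R (y u o c : V) :
    D⟦y, ({u} : Set V)⟧ ∩ {ω | (o = y ∨ ∃ e ∈ openEdgeCluster ω y, o ∈ e) ∧ ¬ (c = y ∨ ∃ e ∈ openEdgeCluster ω y, c ∈ e)} =
      ((openConn y u)ᶜ ∩ openConn y o) \ openConn y c := by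
  ext ω
  simp only [Set.mem_inter_iff, Set.mem_setOf_eq, Set.mem_singleton_iff, forall_eq, memV_iff, Set.mem_compl_iff,
    Set.mem_sdiff, openConn]
  tauto

omit [Fintype V] in
/-- `{y ↮ u} ∩ {o ∈ V(C_y), c ∉ V(C_y)} ∩ {u ↔ b} = ({y ↮ u} ∩ {y ↔ o} ∩ {u ↔ b}) ∖ {y ↔ c}`. [folklore] -/
theorem setId_R_conn (y u o c b : V) :
    D⟦y, ({u} : Set V)⟧ ∩ {ω | (o = y ∨ ∃ e ∈ openEdgeCluster ω y, o ∈ e) ∧ ¬ (c = y ∨ ∃ e ∈ openEdgeCluster ω y, c ∈ e)} ∩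
        openConn u b = ((openConn y u)ᶜ ∩ openConn y o ∩ openConn u b) \ openConn y c := by
  ext ω
  simp only [Set.mem_inter_iff, Set.mem_setOf_eq, Set.mem_singleton_iff, forall_eq, memV_iff, Set.mem_compl_iff,
    Set.mem_sdiff, openConn]
  tauto

/-- **The uncentered covariance transfer** (the `(τ, θ′)`-corner of the kernel (T) at roles `(o,b,u,y,c)`; EXCHCERT-g9 §8–§9).
With `μ = prodBernoulli w`, `N = {c ↮ u}`, `D = {y ↮ u}`, `τ = μ(u ↔ b)` and `c ≠ u`:
`μ(N ∩ {c↔o}) · [τ μ(D ∩ {y↔c}) − μ(D ∩ {y↔c} ∩ {u↔b})] ≤ μ(N) · [τ μ(D ∩ {y↔o}) − μ(D ∩ {y↔o} ∩ {u↔b})]`,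
i.e. `m(o) ≥ μ(o ↔ c | c ↮ u) · m(c)` for the nonnegative "`u–b` drop" `m(x) = E[1{u ∉ C_y} 1{x ∈ C_y}(τ − P(u ↔ b | C_y))]`.
Proof: split `{y ↔ o}` along `{y ↔ c}`; the `{y ↮ c}` part of the right side is `≥ 0` (`real_inter_conn_le`, BHK display (10));
the `{y ↔ c}` part is `step2` (BHK Thm. 1.3 for `C_c` given `c ↮ u`) after identifying the events (`{c↮u} ∩ {y ∈ C_c} = D ∩ {y↔c}` etc.).
[cite: VandenbergHaggstromKahn2005, Thm. 1.3 (p. 6), display (10) (pp. 7–8) — corollary] -/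
theorem uncenteredTransfer (u b y o c : V) (hcu : c ≠ u) :
    (prodBernoulli w).real ((openConn c u)ᶜ ∩ openConn c o) *
        ((prodBernoulli w).real (openConn u b) * (prodBernoulli w).real ((openConn y u)ᶜ ∩ openConn y c) -
          (prodBernoulli w).real ((openConn y u)ᶜ ∩ openConn y c ∩ openConn u b)) ≤
      (prodBernoulli w).real ((openConn c u)ᶜ : Set (BondConfig V)) *
        ((prodBernoulli w).real (openConn u b) * (prodBernoulli w).real ((openConn y u)ᶜ ∩ openConn y o) -
          (prodBernoulli w).real ((openConn y u)ᶜ ∩ openConn y o ∩ openConn u b)) := by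
  -- Step 1: the `{y ↮ c}` part is nonnegative
  have h1 := real_inter_conn_le w y u b
    (fun W => (o = y ∨ ∃ e ∈ W, o ∈ e) ∧ ¬ (c = y ∨ ∃ e ∈ W, c ∈ e))
  rw [setId_R_conn, setId_R] at h1
  -- Step 2: BHK Theorem 1.3 on the `{y ↔ c}` part
  have h2 := step2 w u b y o c hcu
  rw [setId_YO_conn, setId_YO, setId_Y, setId_O, setId_N] at h2
  -- splitting `{y ↮ u} ∩ {y ↔ o}` (and its intersection with `{u ↔ b}`) along `{y ↔ c}`
  have hs1 : (prodBernoulli w).real ((openConn y u)ᶜ ∩ openConn y o ∩ openConn y c) +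
      (prodBernoulli w).real (((openConn y u)ᶜ ∩ openConn y o) \ openConn y c) =
      (prodBernoulli w).real ((openConn y u)ᶜ ∩ openConn y o) :=
    measureReal_inter_add_sdiff (MeasurableSet.of_discrete)
  have hs2 : (prodBernoulli w).real ((openConn y u)ᶜ ∩ openConn y o ∩ openConn u b ∩ openConn y c) +
      (prodBernoulli w).real (((openConn y u)ᶜ ∩ openConn y o ∩ openConn u b) \ openConn y c) =
      (prodBernoulli w).real ((openConn y u)ᶜ ∩ openConn y o ∩ openConn u b) :=
    measureReal_inter_add_sdiff (MeasurableSet.of_discrete)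
  have hN : 0 ≤ (prodBernoulli w).real ((openConn c u)ᶜ : Set (BondConfig V)) := measureReal_nonneg
  have h3 := mul_nonneg hN (sub_nonneg.2 h1)
  rw [← hs1, ← hs2]
  linarith [h2, h3]

end UncenteredTransfer

end

end Summit.CriticalPhenomena.PercolationContinuityZ3.Cruxes.AdditiveGluing.TieLine
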